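import Summits.AtomisticToContinuum.Crystallization.Theorems.PalmUnimodularRigidityShellsToBarlowChartTransportSteps1

/-!
# The four in-layer transports `I, J, I⁻¹, J⁻¹` and the vertical transport `V` of frames read in integer charts (specifications, inverse identities, apexes) (part 1/7) (port to the abstract `1/20` chart clauses)

Port of `Theorems/PalmUnimodularRigidityShellsToBarlowChartTransportSteps1.lean` (crux 9227, line
`develop-the-model-growth-descent`) to the ABSTRACT chart clauses of line `palm-good-law` of crux
stmt-AtomisticToContinuum-13603 (stub R1a4 `stub_combinatorialDevelopment`): the integer-chart hypothesis
`hch : ∀ z ∈ S, IsZChart S z …` is replaced by the section hypothesis `hch` = (pattern `fcc3Int`/`hcpInt`,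
labelling `nb z` bijective onto the bonded neighbours, exact links) at every site ∧ the transfer identity for
every bonded pair; statements and proofs are otherwise verbatim (the transports `Istep, …, frameAt` and the
pattern facts `TransportPatterns*` are reused by name).  All `[folklore]` (HalesDSP2012 §1.3).
-/

noncomputable section

namespace Summit.AtomisticToContinuum.Crystallization.Theorems.PalmGoodLaw.Development

open Literature.Geometry.DiscreteGeometry Literature.MathematicalPhysics.StatisticalMechanics
open Summit.AtomisticToContinuum.Crystallization.Theorems.ShellsToBarlowChartNegative
open Summit.AtomisticToContinuum.Crystallization.Theorems.PalmUnimodularRigidityShellsToBarlowChart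

variable {S : Set (EuclideanSpace ℝ (Fin 3))} {Pc : (EuclideanSpace ℝ (Fin 3)) → Finset (Fin 3 → ℤ)}
  {nb : (EuclideanSpace ℝ (Fin 3)) → (Fin 3 → ℤ) → (EuclideanSpace ℝ (Fin 3))}
  (hch : (∀ z ∈ S, (Pc z = fcc3Int ∨ Pc z = hcpInt) ∧
      Set.BijOn (nb z) (↑(Pc z) : Set (Fin 3 → ℤ)) {y | y ∈ S ∧ (0 < dist z y ∧ dist z y ≤ 28 / 25)} ∧
      (∀ t ∈ Pc z, ∀ t' ∈ Pc z,
        ((0 < dist (nb z t) (nb z t') ∧ dist (nb z t) (nb z t') ≤ 28 / 25) ↔ sqNormInt (t - t') = 18))) ∧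
    (∀ x ∈ S, ∀ y ∈ S, (0 < dist x y ∧ dist x y ≤ 28 / 25) →
      ∀ (z z' : EuclideanSpace ℝ (Fin 3)) (t t' u u' : Fin 3 → ℤ),
        ((t = 0 ∧ z = x) ∨ (t ∈ Pc x ∧ z = nb x t)) → ((t' = 0 ∧ z' = x) ∨ (t' ∈ Pc x ∧ z' = nb x t')) →
        ((u = 0 ∧ z = y) ∨ (u ∈ Pc y ∧ z = nb y u)) → ((u' = 0 ∧ z' = y) ∨ (u' ∈ Pc y ∧ z' = nb y u')) →
        sqNormInt (u - u') = sqNormInt (t - t')))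

include hch in
/-- A labelled neighbour is a site of `S` bonded to the centre. [folklore] -/
theorem nb_mem {x : (EuclideanSpace ℝ (Fin 3))} (hx : x ∈ S)
    {t : Fin 3 → ℤ} (ht : t ∈ Pc x) : nb x t ∈ S ∧ (0 < dist x (nb x t) ∧ dist x (nb x t) ≤ 28 / 25) :=
  (hch.1 x hx).2.1.mapsTo ht

include hch in
/-- The inverse labelling of a bonded neighbour is a label and labels it. [folklore] -/
theorem zlab_spec {y z : (EuclideanSpace ℝ (Fin 3))} (hy : y ∈ S)
    (hz : z ∈ S) (hb : 0 < dist y z ∧ dist y z ≤ 28 / 25) :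
    zlab Pc nb y z ∈ Pc y ∧ nb y (zlab Pc nb y z) = z := by
  have hbij := (hch.1 y hy).2.1
  have hmem : z ∈ {w | w ∈ S ∧ (0 < dist y w ∧ dist y w ≤ 28 / 25)} := ⟨hz, hb⟩
  obtain ⟨t, ht, htz⟩ := hbij.surjOn hmem
  have hex : ∃ t ∈ (↑(Pc y) : Set (Fin 3 → ℤ)), nb y t = z := ⟨t, ht, htz⟩
  exact ⟨Function.invFunOn_mem hex, Function.invFunOn_eq hex⟩

include hch in
/-- The inverse labelling inverts the labelling on labels. [folklore] -/
theorem zlab_nb {y : (EuclideanSpace ℝ (Fin 3))} (hy : y ∈ S)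
    {t : Fin 3 → ℤ} (ht : t ∈ Pc y) : zlab Pc nb y (nb y t) = t :=
  (hch.1 y hy).2.1.invOn_invFunOn.1 ht

include hch in
/-- Bonds among labelled neighbours are the label pairs at squared distance `18`. [folklore] -/
theorem bond_nb_iff {x : (EuclideanSpace ℝ (Fin 3))} (hx : x ∈ S)
    {t t' : Fin 3 → ℤ} (ht : t ∈ Pc x) (ht' : t' ∈ Pc x) :
    (0 < dist (nb x t) (nb x t') ∧ dist (nb x t) (nb x t') ≤ 28 / 25) ↔ sqNormInt (t - t') = 18 :=
  (hch.1 x hx).2.2 t ht t' ht'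

include hch in
/-- The pattern of a chart is FCC or HCP. [folklore] -/
theorem pattern_cases {x : (EuclideanSpace ℝ (Fin 3))} (hx : x ∈ S) :
    Pc x = fcc3Int ∨ Pc x = hcpInt := (hch.1 x hx).1

include hch in
/-- Labels have squared norm `18` (both patterns live in `ℤ³` at squared norm `18`). [folklore] -/
theorem wsqNormInt_eq {x : (EuclideanSpace ℝ (Fin 3))} (hx : x ∈ S) {t : Fin 3 → ℤ} (ht : t ∈ Pc x) :
    sqNormInt t = 18 := by
  rcases pattern_cases hch hx with h | h
  · rw [h] at ht; exact sqNormInt_of_mem_fcc3Int t ht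
  · rw [h] at ht; exact sqNormInt_of_mem_hcpInt t ht

include hch in
/-- **Transfer for two labelled neighbours of `x`** that are also bonded neighbours of the bonded
site `y`: their squared label distance at `y` is the one at `x`. [folklore] -/
theorem transfer_nb_nb {x y : (EuclideanSpace ℝ (Fin 3))}
    (hx : x ∈ S) (hy : y ∈ S) (hxy : 0 < dist x y ∧ dist x y ≤ 28 / 25)
    {t t' : Fin 3 → ℤ} (ht : t ∈ Pc x) (ht' : t' ∈ Pc x)
    (hzt : 0 < dist y (nb x t) ∧ dist y (nb x t) ≤ 28 / 25)
    (hzt' : 0 < dist y (nb x t') ∧ dist y (nb x t') ≤ 28 / 25) :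
    sqNormInt (zlab Pc nb y (nb x t) - zlab Pc nb y (nb x t')) = sqNormInt (t - t') := by
  have h1 := zlab_spec hch hy (nb_mem hch hx ht).1 hzt
  have h2 := zlab_spec hch hy (nb_mem hch hx ht').1 hzt'
  exact hch.2 x hx y hy hxy _ _ _ _ _ _ (Or.inr ⟨ht, rfl⟩) (Or.inr ⟨ht', rfl⟩)
    (Or.inr ⟨h1.1, h1.2.symm⟩) (Or.inr ⟨h2.1, h2.2.symm⟩)

include hch in
/-- **Transfer for a labelled neighbour of `x` and `x` itself**, read at the bonded site `y`:
`D(label of z, label of x) = 18`… more precisely `= sqNormInt t`. [folklore] -/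
theorem transfer_nb_centre {x y : (EuclideanSpace ℝ (Fin 3))}
    (hx : x ∈ S) (hy : y ∈ S) (hxy : 0 < dist x y ∧ dist x y ≤ 28 / 25)
    {t : Fin 3 → ℤ} (ht : t ∈ Pc x) (hzt : 0 < dist y (nb x t) ∧ dist y (nb x t) ≤ 28 / 25) :
    sqNormInt (zlab Pc nb y (nb x t) - zlab Pc nb y x) = sqNormInt t := by
  have h1 := zlab_spec hch hy (nb_mem hch hx ht).1 hzt
  have h2 := zlab_spec hch hy hx (bond_symm hxy)
  have := hch.2 x hx y hy hxy _ _ _ _ _ _ (Or.inr ⟨ht, rfl⟩) (Or.inl ⟨rfl, rfl⟩)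
    (Or.inr ⟨h1.1, h1.2.symm⟩) (Or.inr ⟨h2.1, h2.2.symm⟩)
  rw [this, sub_zero]

include hch in
/-- **Transfer for a labelled neighbour of `x` and `y` itself** (`y = nb x t₀`): the label of
`nb x t` at `y` has `sqNormInt = sqNormInt (t − t₀)`. [folklore] -/
theorem transfer_nb_target {x : (EuclideanSpace ℝ (Fin 3))}
    (hx : x ∈ S) {t₀ t : Fin 3 → ℤ} (ht₀ : t₀ ∈ Pc x) (ht : t ∈ Pc x)
    (hzt : 0 < dist (nb x t₀) (nb x t) ∧ dist (nb x t₀) (nb x t) ≤ 28 / 25) :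
    sqNormInt (zlab Pc nb (nb x t₀) (nb x t)) = sqNormInt (t - t₀) := by
  have hy := nb_mem hch hx ht₀
  have h1 := zlab_spec hch hy.1 (nb_mem hch hx ht).1 hzt
  have := hch.2 x hx _ hy.1 hy.2 _ _ _ _ _ _ (Or.inr ⟨ht, rfl⟩) (Or.inr ⟨ht₀, rfl⟩)
    (Or.inr ⟨h1.1, h1.2.symm⟩) (Or.inl ⟨rfl, rfl⟩)
  rw [sub_zero] at this
  exact this

include hch in
/-- The label of the centre `x` at a labelled neighbour `y = nb x t₀` has squared norm `18`.
[folklore] -/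
theorem sqNormInt_zlab_centre {x : (EuclideanSpace ℝ (Fin 3))}
    (hx : x ∈ S) {t₀ : Fin 3 → ℤ} (ht₀ : t₀ ∈ Pc x) :
    sqNormInt (zlab Pc nb (nb x t₀) x) = 18 := by
  have hy := nb_mem hch hx ht₀
  have h := zlab_spec hch hy.1 hx (bond_symm hy.2)
  exact (wsqNormInt_eq hch hy.1) h.1


/-! ## The in-layer steps -/

include hch in
/-- **The mirror-pair argument** (regime B): if the source pattern of a valid frame is HCP then,
at the neighbour `y = nb x t` for a hexagon label `t`, the labels of `x` and of any common
neighbour touching the transported upper AND lower cap images are equatorial, and `y` is HCP.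
Stated for the data actually used: two common neighbours `u = nb x cu`, `l = nb x cl` of `x, y`
with `sqNormInt (cu − cl) = 48` force `Pc y = hcpInt`, and a label at `y` touching both of
their labels is equatorial. [folklore] -/
theorem hcp_of_mirror_pair {x : (EuclideanSpace ℝ (Fin 3))}
    (hx : x ∈ S) {t cu cl : Fin 3 → ℤ} (ht : t ∈ Pc x) (hcu : cu ∈ Pc x) (hcl : cl ∈ Pc x)
    (h48 : sqNormInt (cu - cl) = 48)
    (hbu : 0 < dist (nb x t) (nb x cu) ∧ dist (nb x t) (nb x cu) ≤ 28 / 25)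
    (hbl : 0 < dist (nb x t) (nb x cl) ∧ dist (nb x t) (nb x cl) ≤ 28 / 25) :
    Pc (nb x t) = hcpInt ∧
      ∀ q ∈ Pc (nb x t), sqNormInt (q - zlab Pc nb (nb x t) (nb x cu)) = 18 →
        sqNormInt (q - zlab Pc nb (nb x t) (nb x cl)) = 18 → -q ∈ Pc (nb x t) := by
  have hy := nb_mem hch hx ht
  have hμ := zlab_spec hch hy.1 (nb_mem hch hx hcu).1 hbu
  have hlam := zlab_spec hch hy.1 (nb_mem hch hx hcl).1 hbl
  have D : sqNormInt (zlab Pc nb (nb x t) (nb x cu) - zlab Pc nb (nb x t) (nb x cl)) = 48 := by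
    rw [transfer_nb_nb hch hx hy.1 hy.2 hcu hcl hbu hbl, h48]
  have hPy : Pc (nb x t) = hcpInt := by
    rcases pattern_cases hch hy.1 with h | h
    · exfalso
      rw [h] at hμ hlam
      exact sqNormInt_sub_ne_48_of_fcc3Int _ hμ.1 _ hlam.1 D
    · exact h
  refine ⟨hPy, fun q hq h1 h2 => ?_⟩
  rw [hPy] at hq hμ hlam ⊢
  exact neg_mem_of_mirror_pair q hq _ hμ.1 _ hlam.1 h1 h2 D

/-- Landing anchor of this file (registered on crux stmt-AtomisticToContinuum-13603; re-exports `mem_hexLabels_iff`). [folklore] -/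
theorem development_steps1_anchor : ∀ (t₁ t₂ p : Fin 3 → ℤ), p ∈ hexLabels t₁ t₂ ↔ p = t₁ ∨ p = t₂ ∨ p = t₂ - t₁ ∨ p = -t₁ ∨ p = -t₂ ∨ p = t₁ - t₂ :=
  fun _ _ _ => mem_hexLabels_iff

end Summit.AtomisticToContinuum.Crystallization.Theorems.PalmGoodLaw.Development

end
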